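import Mathlib.Topology.MetricSpace.Holder
import Literature.Analysis.Calculus.DerivativeInterpolation
import Literature.Analysis.FluidPDE.SuitableWeak
import HarnessLib

/-!
# Hölder continuity of spatial derivatives by interpolation (Landau–Kolmogorov on balls)

Analysis/FluidPDE proofs file (theorems only: no definitions, no named facts, no `sorry`).
Elementary real analysis in the service of the quantitative interior regularity statements of
this directory (`NSBoundedHigherRegularityBounds`, `NSBoundedHigherRegularity`,
`SereginSverak2009.LocalHolderBound`, …), whose conclusions ask for **joint** `(t, x)`-Hölder
continuity of the spatial derivatives `w ↦ D_xⁿV(w)` of a representative on parabolic cylinders,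
with constants fixed before the solution. The bootstrap arguments (Serrin 1962;
Seregin–Šverák 2009, §2 p. 8; Lemarié-Rieusset 2016, Thm. 13.1) deliver

* uniform bounds `‖D_x^m V‖ ≤ K m` of all spatial derivatives on the inner cylinders, and
* at level zero, a joint Hölder modulus of `V` itself (the time regularity goes through the
  pressure; in the tree: `SliceTimeHolderQuant.exists_holderOnWith_representative_quant`,
  `SereginSverak2009.LocalHolderBound_holds`),

and the passage from these two to the Hölder continuity of every `D_xⁿV` in `(t, x)` is the
classical interpolation (Landau–Kolmogorov) inequality on balls — in the tree as
`Literature.Analysis.Calculus.norm_fderiv_le_of_norm_le_of_lipschitz`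
(`Analysis/Calculus/DerivativeInterpolation.lean`, which draws the *qualitative* consequences:
convergence and joint continuity of derivatives). This file draws the *quantitative* consequence,
a Hölder modulus with constants fixed before the family:

* `DerivInterp.norm_iteratedFDeriv_succ_sub_le` — one interpolation step for two functions
  which are `C^{k+2}` at the points of a ball only (slices of a representative):
  `‖D^{k+1}f₁(x) - D^{k+1}f₂(x)‖ ≤ 2A/ρ + 2Kρ` if `‖D^k f₁ - D^k f₂‖ ≤ A`, `‖D^{k+2}fᵢ‖ ≤ K` on
  `B(x, h)`;
* `DerivInterp.time_modulus_iteratedFDeriv` — for a family `V(t, ·)`, `t ∈ T`, with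
  `‖D^m V(t)‖ ≤ K m` (`m ≤ n + 1`) on `B(x₀, R)` and `‖V(t, y) - V(s, y)‖ ≤ C₀ |t - s|^α`, one gets
  `‖DᵏV(t)(y) - DᵏV(s)(y)‖ ≤ C_k |t - s|^{α/2ᵏ}` on `B(x₀, R - kδ)`, `k ≤ n`, with `C_k` depending
  only on `k, δ, K, C₀` (induction on `k`, `ρ = δ |t - s|^{α/2^{k+1}}`);
* `DerivInterp.exists_holderOnWith_iteratedFDeriv_prod` — hence `w ↦ DⁿV(w)` is Hölder on
  `T × B(x₀, r)`, `r < R`, for the sup product metric of `ℝ × E`, exponent `min(α, 1)/2ⁿ`,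
  constants fixed before the family;
* `DerivInterp.exists_holderOnWith_iteratedFDeriv_parabolicCylinder`,
  `…_parabolicCylinderCentered`, `…_parabolicCylinder_smooth` — the same on the backward /
  centred parabolic cylinders `Q(z, r) ⊆ Q(z, R)` of `SuitableWeak.lean`, in the exact format of
  the clauses of `NSBoundedHigherRegularityBounds` (`HolderOnWith (C n) (α n)
  (fun w => iteratedFDeriv ℝ n (V w.1) w.2) (parabolicCylinder r z)` from
  `HolderOnWith C₀ α₀ (uncurry V) (parabolicCylinder R z)`, `C^∞` slices and the sup bounds).

Everything is stated for maps `E → F` between real normed spaces (`E` the space variable) and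
families indexed by an arbitrary `T ⊆ ℝ`. The exponents halve at each order (`α/2ⁿ`); the
optimal Kolmogorov exponents are not needed by the consumers, which only ask for positivity.

## References

* E. Landau, *Einige Ungleichungen für zweimal differentiierbare Funktionen*, Proc. London
  Math. Soc. (2) 13 (1913) 43–49; A. N. Kolmogorov, Uchen. Zap. MGU Mat. 30 (1939) 3–16
  (the interpolation inequalities between derivatives). [folklore]
* J. Serrin, Arch. Rational Mech. Anal. 9 (1962) 187–195; G. Seregin, V. Šverák, Comm. PDE 34
  (2009) = arXiv:0804.1803, §2 p. 8 ("for any natural `k`, `z = (x,t) ↦ ∇ᵏv(z)` is Hölder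
  continuous … the corresponding norms are estimated by constants depending on [the data]").
  [`SereginSverak2009`]
-/

noncomputable section

open Set Function Metric
open scoped NNReal ENNReal Topology

namespace Literature.Analysis.FluidPDE

namespace DerivInterp

open Literature.Analysis.Calculus

variable {E F : Type*} [NormedAddCommGroup E] [NormedSpace ℝ E]
  [NormedAddCommGroup F] [NormedSpace ℝ F]

/-! ### One interpolation step for iterated derivatives of two functions -/

/-- **Lipschitz bound for an iterated derivative from a bound on the next one** (mean value
inequality on the ball): if `f` is `C^{k+2}` at the points of `B(x, h)` with `‖D^{k+2}f‖ ≤ K`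
there, then `‖D^{k+1}f(y) - D^{k+1}f(y')‖ ≤ K‖y - y'‖` for `y, y' ∈ B(x, h)`. [folklore] -/
theorem norm_iteratedFDeriv_sub_le_of_bound_ball {f : E → F} {x : E} {h K : ℝ} {k : ℕ} {N : WithTop ℕ∞}
    (hf : ∀ y ∈ ball x h, ContDiffAt ℝ N f y) (hN : ((k + 2 : ℕ) : WithTop ℕ∞) ≤ N)
    (hK : ∀ y ∈ ball x h, ‖iteratedFDeriv ℝ (k + 2) f y‖ ≤ K)
    {y y' : E} (hy : y ∈ ball x h) (hy' : y' ∈ ball x h) :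
    ‖iteratedFDeriv ℝ (k + 1) f y - iteratedFDeriv ℝ (k + 1) f y'‖ ≤ K * ‖y - y'‖ := by
  have hlt : ((k + 1 : ℕ) : WithTop ℕ∞) < N :=
    lt_of_lt_of_le (by exact_mod_cast Nat.lt_succ_self (k + 1)) hN
  refine (convex_ball x h).norm_image_sub_le_of_norm_fderiv_le
    (fun z hz => (hf z hz).differentiableAt_iteratedFDeriv hlt) (fun z hz => ?_) hy' hy
  rw [norm_fderiv_iteratedFDeriv]
  exact hK z hz

/-- **One interpolation step for the difference of two functions.** If `f₁, f₂` are `C^{k+2}`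
at the points of `B(x, h)`, `‖D^k f₁ - D^k f₂‖ ≤ A` and `‖D^{k+2} fᵢ‖ ≤ K` on `B(x, h)`, then for
every `0 < ρ < h`, `‖D^{k+1}f₁(x) - D^{k+1}f₂(x)‖ ≤ 2A/ρ + 2Kρ` (Landau's
inequality for `g = D^k f₁ - D^k f₂`, whose derivative is `D^{k+1}f₁ - D^{k+1}f₂`
read through the currying isometry and is `2K`-Lipschitz by the mean value inequality; Landau's
inequality itself is the tree's `Calculus.norm_fderiv_le_of_norm_le_of_lipschitz`). [folklore] -/
theorem norm_iteratedFDeriv_succ_sub_le {f₁ f₂ : E → F} {x : E} {h A K : ℝ} {k : ℕ} {N : WithTop ℕ∞}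
    (h₁ : ∀ y ∈ ball x h, ContDiffAt ℝ N f₁ y) (h₂ : ∀ y ∈ ball x h, ContDiffAt ℝ N f₂ y)
    (hN : ((k + 2 : ℕ) : WithTop ℕ∞) ≤ N)
    (hA : ∀ y ∈ ball x h, ‖iteratedFDeriv ℝ k f₁ y - iteratedFDeriv ℝ k f₂ y‖ ≤ A)
    (hK0 : 0 ≤ K) (hK₁ : ∀ y ∈ ball x h, ‖iteratedFDeriv ℝ (k + 2) f₁ y‖ ≤ K)
    (hK₂ : ∀ y ∈ ball x h, ‖iteratedFDeriv ℝ (k + 2) f₂ y‖ ≤ K)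
    {ρ : ℝ} (hρ : 0 < ρ) (hρh : ρ < h) :
    ‖iteratedFDeriv ℝ (k + 1) f₁ x - iteratedFDeriv ℝ (k + 1) f₂ x‖ ≤ 2 * A / ρ + 2 * K * ρ := by
  set L := continuousMultilinearCurryLeftEquiv ℝ (fun _ : Fin (k + 1) => E) F with hL
  set g : E → (ContinuousMultilinearMap ℝ (fun _ : Fin k => E) F) :=
    fun y => iteratedFDeriv ℝ k f₁ y - iteratedFDeriv ℝ k f₂ y with hg
  have hxh : x ∈ ball x h := mem_ball_self (hρ.trans hρh)
  have hlt : ((k : ℕ) : WithTop ℕ∞) < N :=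
    lt_of_lt_of_le (by exact_mod_cast (by omega : k < k + 2)) hN
  have hd₁ : ∀ y ∈ ball x h, DifferentiableAt ℝ (iteratedFDeriv ℝ k f₁) y :=
    fun y hy => (h₁ y hy).differentiableAt_iteratedFDeriv hlt
  have hd₂ : ∀ y ∈ ball x h, DifferentiableAt ℝ (iteratedFDeriv ℝ k f₂) y :=
    fun y hy => (h₂ y hy).differentiableAt_iteratedFDeriv hlt
  have hdg : ∀ y ∈ ball x h, DifferentiableAt ℝ g y := fun y hy => (hd₁ y hy).sub (hd₂ y hy)
  -- the derivative of `g`, through the currying isometry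
  have hfd : ∀ y ∈ ball x h, fderiv ℝ g y =
      L (iteratedFDeriv ℝ (k + 1) f₁ y - iteratedFDeriv ℝ (k + 1) f₂ y) := by
    intro y hy
    rw [hg, fderiv_fun_sub (hd₁ y hy) (hd₂ y hy), fderiv_iteratedFDeriv_apply_eq_curry,
      fderiv_iteratedFDeriv_apply_eq_curry, ← LinearIsometryEquiv.map_sub]
  -- Landau's inequality for `g`
  have hB : ∀ y ∈ ball x h, ‖fderiv ℝ g y - fderiv ℝ g x‖ ≤ 2 * K * ‖y - x‖ := by
    intro y hy
    rw [hfd y hy, hfd x hxh, ← LinearIsometryEquiv.map_sub, LinearIsometryEquiv.norm_map]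
    calc ‖iteratedFDeriv ℝ (k + 1) f₁ y - iteratedFDeriv ℝ (k + 1) f₂ y -
          (iteratedFDeriv ℝ (k + 1) f₁ x - iteratedFDeriv ℝ (k + 1) f₂ x)‖
        = ‖(iteratedFDeriv ℝ (k + 1) f₁ y - iteratedFDeriv ℝ (k + 1) f₁ x) -
            (iteratedFDeriv ℝ (k + 1) f₂ y - iteratedFDeriv ℝ (k + 1) f₂ x)‖ := by
          congr 1; abel
      _ ≤ ‖iteratedFDeriv ℝ (k + 1) f₁ y - iteratedFDeriv ℝ (k + 1) f₁ x‖ +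
            ‖iteratedFDeriv ℝ (k + 1) f₂ y - iteratedFDeriv ℝ (k + 1) f₂ x‖ := norm_sub_le _ _
      _ ≤ K * ‖y - x‖ + K * ‖y - x‖ :=
          add_le_add (norm_iteratedFDeriv_sub_le_of_bound_ball h₁ hN hK₁ hy hxh)
            (norm_iteratedFDeriv_sub_le_of_bound_ball h₂ hN hK₂ hy hxh)
      _ = 2 * K * ‖y - x‖ := by ring
  have hmain := norm_fderiv_le_of_norm_le_of_lipschitz hdg hA (by positivity) hB hρ hρh
  rw [hfd x hxh, LinearIsometryEquiv.norm_map] at hmain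
  linarith [hmain]

/-! ### The time modulus of the spatial derivatives, by induction on the order -/

/-- The order-zero derivatives of two functions differ in norm exactly as the functions do.
[folklore] -/
theorem norm_iteratedFDeriv_zero_sub (f₁ f₂ : E → F) (y : E) :
    ‖iteratedFDeriv ℝ 0 f₁ y - iteratedFDeriv ℝ 0 f₂ y‖ = ‖f₁ y - f₂ y‖ := by
  have h : iteratedFDeriv ℝ 0 f₁ y - iteratedFDeriv ℝ 0 f₂ y = iteratedFDeriv ℝ 0 (f₁ - f₂) y := by
    ext m
    simp [iteratedFDeriv_zero_apply]
  rw [h, norm_iteratedFDeriv_zero, Pi.sub_apply]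

/-- **Time modulus of the spatial derivatives by interpolation (Landau–Kolmogorov), all
constants fixed before the family.** Let `n` be an order, `δ > 0` a margin, `K m ≥ 0` bounds,
`C₀ ≥ 0`, `α ≥ 0`. For every `k ≤ n` there is `C ≥ 0` such that: for every family
`V : ℝ → E → F` indexed by `t ∈ T` whose members are `C^N` (`N ≥ n + 1`) at the points of
`B(x₀, R)` with `‖D^m V(t)‖ ≤ K m` there (`m ≤ n + 1`) and `‖V(t, y) - V(s, y)‖ ≤ C₀|t - s|^α`
(`t, s ∈ T`, `y ∈ B(x₀, R)`), one has
`‖D^k V(t)(y) - D^k V(s)(y)‖ ≤ C |t - s|^{α/2^k}` for `t, s ∈ T`, `y ∈ B(x₀, R - kδ)`.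
(Induction on `k`: the step is `norm_iteratedFDeriv_succ_sub_le` on `B(y, δ)` with
`ρ = δ|t - s|^{β/2}`, `β = α/2^k`, when `0 < |t - s| ≤ 1`, and the trivial bound `2K_{k+1}`
when `|t - s| > 1`; `C_{k+1} = 2C_k/δ + 2K_{k+2}δ + 2K_{k+1}`.) [folklore] -/
theorem time_modulus_iteratedFDeriv (n : ℕ) {N : WithTop ℕ∞} (hN : ((n + 1 : ℕ) : WithTop ℕ∞) ≤ N)
    {R δ : ℝ} (hδ : 0 < δ) (K : ℕ → ℝ) (hK0 : ∀ m, 0 ≤ K m) {C₀ α : ℝ} (hC₀ : 0 ≤ C₀) (hα : 0 ≤ α) :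
    ∀ k ≤ n, ∃ C : ℝ, 0 ≤ C ∧
      ∀ (V : ℝ → E → F) (T : Set ℝ) (x₀ : E),
        (∀ t ∈ T, ∀ y ∈ ball x₀ R, ContDiffAt ℝ N (V t) y) →
        (∀ m ≤ n + 1, ∀ t ∈ T, ∀ y ∈ ball x₀ R, ‖iteratedFDeriv ℝ m (V t) y‖ ≤ K m) →
        (∀ t ∈ T, ∀ s ∈ T, ∀ y ∈ ball x₀ R, ‖V t y - V s y‖ ≤ C₀ * |t - s| ^ α) →
        ∀ t ∈ T, ∀ s ∈ T, ∀ y ∈ ball x₀ (R - k * δ),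
          ‖iteratedFDeriv ℝ k (V t) y - iteratedFDeriv ℝ k (V s) y‖ ≤ C * |t - s| ^ (α / 2 ^ k) := by
  intro k
  induction k with
  | zero =>
    intro _
    refine ⟨C₀, hC₀, fun V T x₀ _ _ h0 t ht s hs y hy => ?_⟩
    rw [norm_iteratedFDeriv_zero_sub, pow_zero, div_one]
    have hy' : y ∈ ball x₀ R := by simpa using hy
    exact h0 t ht s hs y hy'
  | succ k ih =>
    intro hk
    obtain ⟨C, hC, hmod⟩ := ih (Nat.le_of_succ_le hk)
    have hK1 := hK0 (k + 1)
    have hK2 := hK0 (k + 2)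
    refine ⟨2 * C / δ + 2 * K (k + 2) * δ + 2 * K (k + 1), by positivity, ?_⟩
    intro V T x₀ hV hK h0 t ht s hs y hy
    have hkN : ((k + 2 : ℕ) : WithTop ℕ∞) ≤ N :=
      le_trans (by exact_mod_cast (by omega : k + 2 ≤ n + 1)) hN
    set τ : ℝ := |t - s| with hτ
    set β : ℝ := α / 2 ^ k with hβ
    have hβ0 : 0 ≤ β := by positivity
    have hβ' : α / 2 ^ (k + 1) = β / 2 := by rw [hβ, pow_succ]; ring
    rw [hβ']
    have hτ0 : 0 ≤ τ := abs_nonneg _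
    have hkδ : 0 ≤ (k : ℝ) * δ := by positivity
    have hyR : y ∈ ball x₀ R := by
      refine ball_subset_ball ?_ hy
      push_cast
      nlinarith
    -- the trivial bound
    have htriv : ‖iteratedFDeriv ℝ (k + 1) (V t) y - iteratedFDeriv ℝ (k + 1) (V s) y‖ ≤
        2 * K (k + 1) :=
      (norm_sub_le _ _).trans (by linarith [hK (k + 1) (by omega) t ht y hyR, hK (k + 1) (by omega) s hs y hyR])
    have hcoef : 0 ≤ 2 * C / δ + 2 * K (k + 2) * δ := by positivity
    rcases le_or_gt τ 1 with hτ1 | hτ1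
    · rcases hτ0.eq_or_lt with hτ00 | hτpos
      · -- `t = s`
        have hts : t = s := by
          have : |t - s| = 0 := hτ00.symm
          linarith [abs_eq_zero.1 this]
        subst hts
        rw [sub_self, norm_zero]
        positivity
      · -- the interpolation step on `B(y, h₀)`, `h₀ = R - kδ - dist y x₀ > δ`
        set h₀ : ℝ := R - k * δ - dist y x₀ with hh₀def
        have hyk : dist y x₀ < R - (k + 1 : ℕ) * δ := mem_ball.1 hy
        have hh₀ : δ < h₀ := by
          rw [hh₀def]; push_cast at hyk; linarith
        have hsub : ball y h₀ ⊆ ball x₀ (R - k * δ) := by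
          intro y' hy'
          rw [mem_ball] at hy' ⊢
          linarith [dist_triangle y' y x₀]
        have hsubR : ball y h₀ ⊆ ball x₀ R := hsub.trans (ball_subset_ball (by linarith))
        set ρ : ℝ := δ * τ ^ (β / 2) with hρdef
        have hτβ : 0 < τ ^ (β / 2) := Real.rpow_pos_of_pos hτpos _
        have hρ0 : 0 < ρ := mul_pos hδ hτβ
        have hρδ : ρ ≤ δ :=
          mul_le_of_le_one_right hδ.le (Real.rpow_le_one hτ0 hτ1 (by positivity))
        have step := norm_iteratedFDeriv_succ_sub_le (k := k) (x := y) (h := h₀) (A := C * τ ^ β)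
          (K := K (k + 2)) (fun y' hy' => hV t ht y' (hsubR hy')) (fun y' hy' => hV s hs y' (hsubR hy'))
          hkN (fun y' hy' => hmod V T x₀ hV hK h0 t ht s hs y' (hsub hy')) hK2
          (fun y' hy' => hK (k + 2) (by omega) t ht y' (hsubR hy'))
          (fun y' hy' => hK (k + 2) (by omega) s hs y' (hsubR hy')) hρ0 (hρδ.trans_lt hh₀)
        have e1 : 2 * (C * τ ^ β) / ρ = 2 * C / δ * τ ^ (β / 2) := by
          have hsplit : τ ^ β = τ ^ (β / 2) * τ ^ (β / 2) := by
            rw [← Real.rpow_add hτpos]; ring_nf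
          rw [hsplit, hρdef]
          field_simp
        calc ‖iteratedFDeriv ℝ (k + 1) (V t) y - iteratedFDeriv ℝ (k + 1) (V s) y‖
            ≤ 2 * (C * τ ^ β) / ρ + 2 * K (k + 2) * ρ := step
          _ = (2 * C / δ + 2 * K (k + 2) * δ) * τ ^ (β / 2) := by rw [e1, hρdef]; ring
          _ ≤ (2 * C / δ + 2 * K (k + 2) * δ + 2 * K (k + 1)) * τ ^ (β / 2) :=
              mul_le_mul_of_nonneg_right (by linarith) hτβ.le
    · -- `|t - s| > 1`: the trivial bound
      have h1 : 1 ≤ τ ^ (β / 2) := Real.one_le_rpow hτ1.le (by positivity)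
      calc ‖iteratedFDeriv ℝ (k + 1) (V t) y - iteratedFDeriv ℝ (k + 1) (V s) y‖
          ≤ 2 * K (k + 1) := htriv
        _ ≤ 2 * K (k + 1) * τ ^ (β / 2) := le_mul_of_one_le_right (by positivity) h1
        _ ≤ (2 * C / δ + 2 * K (k + 2) * δ + 2 * K (k + 1)) * τ ^ (β / 2) :=
            mul_le_mul_of_nonneg_right (by linarith) (zero_le_one.trans h1)

/-! ### Packaging: Hölder continuity on product sets and on parabolic cylinders -/

/-- A real bound `‖f w - f w'‖ ≤ K d(w, w')^κ` on a set is a `HolderOnWith` bound. [folklore] -/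
private theorem holderOnWith_of_norm_le {X Y : Type*} [PseudoMetricSpace X] [NormedAddCommGroup Y]
    {f : X → Y} {s : Set X} {K κ : ℝ≥0}
    (h : ∀ x ∈ s, ∀ y ∈ s, ‖f x - f y‖ ≤ K * dist x y ^ (κ : ℝ)) : HolderOnWith K κ f s := by
  intro x hx y hy
  rw [edist_dist, edist_dist, dist_eq_norm]
  refine (ENNReal.ofReal_le_ofReal (h x hx y hy)).trans_eq ?_
  rw [ENNReal.ofReal_mul' (Real.rpow_nonneg dist_nonneg _), ENNReal.ofReal_coe_nnreal]
  congr 1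
  exact (ENNReal.ofReal_rpow_of_nonneg dist_nonneg κ.2).symm

/-- `0 ≤ p ≤ a`, `p ≤ b` and `θ ∈ [0, 1]` give `p ≤ a^θ b^{1-θ}`. [folklore] -/
private theorem le_rpow_mul_rpow {p a b θ : ℝ} (hp : 0 ≤ p) (ha : p ≤ a) (hb : p ≤ b)
    (hθ0 : 0 ≤ θ) (hθ1 : θ ≤ 1) : p ≤ a ^ θ * b ^ (1 - θ) := by
  have hsplit : p = p ^ θ * p ^ (1 - θ) := by
    rw [← Real.rpow_add' hp (ne_of_gt (by linarith))]
    norm_num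
  calc p = p ^ θ * p ^ (1 - θ) := hsplit
    _ ≤ a ^ θ * b ^ (1 - θ) :=
        mul_le_mul (Real.rpow_le_rpow hp ha hθ0) (Real.rpow_le_rpow hp hb (by linarith))
          (Real.rpow_nonneg hp _) (Real.rpow_nonneg (hp.trans ha) _)

/-- **Hölder continuity of `D_xⁿV` on `T × B(x₀, r)` for the product metric, constants fixed
before the family.** For an order `n`, radii `r < R`, bounds `K m`, a constant `C₀` and an
exponent `α > 0` there are `C` and `β > 0` (namely `β = min(α, 1)/2ⁿ`) such that: whenever
`V : ℝ → E → F`, `t ∈ T`, has `C^N` members (`N ≥ n + 1`) at the points of `B(x₀, R)` with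
`‖D^m V(t)‖ ≤ K m` there (`m ≤ n + 1`) and the time modulus `‖V(t, y) - V(s, y)‖ ≤ C₀|t - s|^α`
(`t, s ∈ T`, `y ∈ B(x₀, R)`), the map `(t, x) ↦ DⁿV(t)(x)` is `(C, β)`-Hölder on
`T × B(x₀, r) ⊆ ℝ × E` (sup product metric). (Time direction: `time_modulus_iteratedFDeriv`
with margin `δ = (R - r)/(n + 1)`; space direction: the mean value inequality with
`‖D^{n+1}V‖ ≤ K_{n+1}`, interpolated against the trivial bound `2K_n`.) [folklore] -/
theorem exists_holderOnWith_iteratedFDeriv_prod (n : ℕ) {N : WithTop ℕ∞}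
    (hN : ((n + 1 : ℕ) : WithTop ℕ∞) ≤ N) {r R : ℝ} (hrR : r < R) (K : ℕ → ℝ≥0) (C₀ α : ℝ≥0)
    (hα : 0 < α) :
    ∃ C β : ℝ≥0, 0 < β ∧ ∀ (V : ℝ → E → F) (T : Set ℝ) (x₀ : E),
      (∀ t ∈ T, ∀ y ∈ ball x₀ R, ContDiffAt ℝ N (V t) y) →
      (∀ m ≤ n + 1, ∀ t ∈ T, ∀ y ∈ ball x₀ R, ‖iteratedFDeriv ℝ m (V t) y‖ ≤ K m) →
      (∀ t ∈ T, ∀ s ∈ T, ∀ y ∈ ball x₀ R, ‖V t y - V s y‖ ≤ C₀ * |t - s| ^ (α : ℝ)) →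
      HolderOnWith C β (fun w : ℝ × E => iteratedFDeriv ℝ n (V w.1) w.2) (T ×ˢ ball x₀ r) := by
  -- margins and the reduced exponent
  have hRr : 0 < R - r := by linarith
  set δ : ℝ := (R - r) / (n + 1) with hδ
  have hδ0 : 0 < δ := by rw [hδ]; positivity
  set α₁ : ℝ := min (α : ℝ) 1 with hα₁
  have hα₁0 : 0 < α₁ := lt_min (by exact_mod_cast hα) one_pos
  have hα₁1 : α₁ ≤ 1 := min_le_right _ _
  have hα₁α : α₁ ≤ α := min_le_left _ _
  have hK0' : ∀ m, 0 ≤ ((K m : ℝ≥0) : ℝ) := fun m => (K m).coe_nonneg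
  have hC₀' : 0 ≤ (C₀ : ℝ) + 2 * K 0 := by positivity
  obtain ⟨C, hC, hmod⟩ := time_modulus_iteratedFDeriv (E := E) (F := F) n hN (R := R) hδ0
    (fun m => (K m : ℝ)) hK0' hC₀' hα₁0.le n le_rfl
  set β : ℝ := α₁ / 2 ^ n with hβ
  have hβ0 : 0 < β := by positivity
  have hβ1 : β ≤ 1 := by
    rw [hβ, div_le_one (by positivity)]
    exact hα₁1.trans (one_le_pow₀ (by norm_num))
  set Cs : ℝ := (K (n + 1) : ℝ) ^ β * (2 * K n) ^ (1 - β) with hCs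
  have hCs0 : 0 ≤ Cs := by positivity
  have hnN : ((n : ℕ) : WithTop ℕ∞) < N :=
    lt_of_lt_of_le (by exact_mod_cast Nat.lt_succ_self n) hN
  -- the inner ball
  have hrn : r ≤ R - n * δ := by
    have h1 : (n : ℝ) * δ = (R - r) * (n / (n + 1)) := by rw [hδ]; ring
    have h2 : (n : ℝ) / (n + 1) ≤ 1 := by rw [div_le_one (by positivity)]; linarith
    nlinarith [mul_le_mul_of_nonneg_left h2 hRr.le]
  refine ⟨(C + Cs).toNNReal, β.toNNReal, Real.toNNReal_pos.2 hβ0, fun V T x₀ hV hK h0 => ?_⟩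
  -- the reduced time hypothesis, exponent `α₁ ≤ 1`
  have h0' : ∀ t ∈ T, ∀ s ∈ T, ∀ y ∈ ball x₀ R,
      ‖V t y - V s y‖ ≤ ((C₀ : ℝ) + 2 * K 0) * |t - s| ^ α₁ := by
    intro t ht s hs y hy
    have hτ0 : 0 ≤ |t - s| := abs_nonneg _
    rcases le_or_gt |t - s| 1 with h1 | h1
    · calc ‖V t y - V s y‖ ≤ C₀ * |t - s| ^ (α : ℝ) := h0 t ht s hs y hy
        _ ≤ C₀ * |t - s| ^ α₁ :=
            mul_le_mul_of_nonneg_left (Real.rpow_le_rpow_of_exponent_ge' hτ0 h1 hα₁0.le hα₁α)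
              C₀.coe_nonneg
        _ ≤ ((C₀ : ℝ) + 2 * K 0) * |t - s| ^ α₁ :=
            mul_le_mul_of_nonneg_right (by linarith [hK0' 0]) (Real.rpow_nonneg hτ0 _)
    · have hV0 : ∀ t ∈ T, ‖V t y‖ ≤ K 0 := fun t ht => by
        have := hK 0 (Nat.zero_le _) t ht y hy
        rwa [norm_iteratedFDeriv_zero] at this
      calc ‖V t y - V s y‖ ≤ 2 * K 0 := (norm_sub_le _ _).trans (by linarith [hV0 t ht, hV0 s hs])
        _ ≤ ((C₀ : ℝ) + 2 * K 0) * 1 := by linarith [C₀.coe_nonneg]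
        _ ≤ ((C₀ : ℝ) + 2 * K 0) * |t - s| ^ α₁ :=
            mul_le_mul_of_nonneg_left (Real.one_le_rpow h1.le hα₁0.le) hC₀'
  have hmod' := hmod V T x₀ hV (fun m hm t ht y hy => hK m hm t ht y hy) h0'
  refine holderOnWith_of_norm_le fun w hw w' hw' => ?_
  obtain ⟨ht, hx⟩ := mem_prod.1 hw
  obtain ⟨hs, hy⟩ := mem_prod.1 hw'
  rw [Real.coe_toNNReal _ (by positivity), Real.coe_toNNReal _ hβ0.le]
  set d : ℝ := dist w w' with hd
  have hτd : |w.1 - w'.1| ≤ d := by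
    rw [hd, Prod.dist_eq, ← Real.dist_eq]; exact le_max_left _ _
  have hed : ‖w.2 - w'.2‖ ≤ d := by
    rw [hd, Prod.dist_eq, ← dist_eq_norm]; exact le_max_right _ _
  have hxn : w.2 ∈ ball x₀ (R - n * δ) := ball_subset_ball hrn hx
  have hxR : w.2 ∈ ball x₀ R := ball_subset_ball hrR.le hx
  have hyR : w'.2 ∈ ball x₀ R := ball_subset_ball hrR.le hy
  -- time piece
  have hA : ‖iteratedFDeriv ℝ n (V w.1) w.2 - iteratedFDeriv ℝ n (V w'.1) w.2‖ ≤ C * d ^ β :=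
    (hmod' w.1 ht w'.1 hs w.2 hxn).trans
      (mul_le_mul_of_nonneg_left (Real.rpow_le_rpow (abs_nonneg _) hτd hβ0.le) hC)
  -- space piece
  have hB1 : ‖iteratedFDeriv ℝ n (V w'.1) w.2 - iteratedFDeriv ℝ n (V w'.1) w'.2‖ ≤
      K (n + 1) * ‖w.2 - w'.2‖ :=
    (convex_ball x₀ R).norm_image_sub_le_of_norm_fderiv_le
      (fun z hz => (hV w'.1 hs z hz).differentiableAt_iteratedFDeriv hnN)
      (fun z hz => by rw [norm_fderiv_iteratedFDeriv]; exact hK (n + 1) le_rfl w'.1 hs z hz) hyR hxR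
  have hB2 : ‖iteratedFDeriv ℝ n (V w'.1) w.2 - iteratedFDeriv ℝ n (V w'.1) w'.2‖ ≤ 2 * K n :=
    (norm_sub_le _ _).trans
      (by linarith [hK n (Nat.le_succ n) w'.1 hs w.2 hxR, hK n (Nat.le_succ n) w'.1 hs w'.2 hyR])
  have hB : ‖iteratedFDeriv ℝ n (V w'.1) w.2 - iteratedFDeriv ℝ n (V w'.1) w'.2‖ ≤ Cs * d ^ β := by
    calc ‖iteratedFDeriv ℝ n (V w'.1) w.2 - iteratedFDeriv ℝ n (V w'.1) w'.2‖
        ≤ ((K (n + 1) : ℝ) * ‖w.2 - w'.2‖) ^ β * (2 * K n) ^ (1 - β) :=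
          le_rpow_mul_rpow (norm_nonneg _) hB1 hB2 hβ0.le hβ1
      _ = Cs * ‖w.2 - w'.2‖ ^ β := by
          rw [Real.mul_rpow (hK0' (n + 1)) (norm_nonneg _), hCs]; ring
      _ ≤ Cs * d ^ β := mul_le_mul_of_nonneg_left (Real.rpow_le_rpow (norm_nonneg _) hed hβ0.le) hCs0
  calc ‖iteratedFDeriv ℝ n (V w.1) w.2 - iteratedFDeriv ℝ n (V w'.1) w'.2‖
      ≤ ‖iteratedFDeriv ℝ n (V w.1) w.2 - iteratedFDeriv ℝ n (V w'.1) w.2‖ +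
          ‖iteratedFDeriv ℝ n (V w'.1) w.2 - iteratedFDeriv ℝ n (V w'.1) w'.2‖ :=
        norm_sub_le_norm_sub_add_norm_sub _ _ _
    _ ≤ C * d ^ β + Cs * d ^ β := add_le_add hA hB
    _ = (C + Cs) * d ^ β := by ring

/-- **Hölder continuity of `D_xⁿV` on backward parabolic cylinders, constants fixed before the
solution** (the format of the clauses of `NSBoundedHigherRegularityBounds`): for an order `n`,
radii `0 < r < R`, bounds `K m`, `C₀` and `α₀ > 0` there are `C`, `α > 0` such that whenever the
slices of `V : ℝ → E → F` are `C^N` (`N ≥ n + 1`) at the points of `Q(z, R)` with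
`‖D_x^m V‖ ≤ K m` there (`m ≤ n + 1`) and `V` is `(C₀, α₀)`-Hölder on `Q(z, R)` (sup product
metric of `ℝ × E`), the map `w ↦ D_xⁿV(w)` is `(C, α)`-Hölder on `Q(z, r)`. (The previous theorem
with `T = ]t₀ - R², t₀[`; only the time modulus at fixed `x` of the Hölder hypothesis is used.)
[folklore] -/
theorem exists_holderOnWith_iteratedFDeriv_parabolicCylinder (n : ℕ) {N : WithTop ℕ∞}
    (hN : ((n + 1 : ℕ) : WithTop ℕ∞) ≤ N) {r R : ℝ} (hr : 0 < r) (hrR : r < R) (K : ℕ → ℝ≥0)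
    (C₀ α₀ : ℝ≥0) (hα₀ : 0 < α₀) :
    ∃ C α : ℝ≥0, 0 < α ∧ ∀ (V : ℝ → E → F) (z : ℝ × E),
      (∀ w ∈ parabolicCylinder R z, ContDiffAt ℝ N (V w.1) w.2) →
      (∀ m ≤ n + 1, ∀ w ∈ parabolicCylinder R z, ‖iteratedFDeriv ℝ m (V w.1) w.2‖ ≤ K m) →
      HolderOnWith C₀ α₀ (uncurry V) (parabolicCylinder R z) →
      HolderOnWith C α (fun w : ℝ × E => iteratedFDeriv ℝ n (V w.1) w.2) (parabolicCylinder r z) := by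
  obtain ⟨C, β, hβ, h⟩ :=
    exists_holderOnWith_iteratedFDeriv_prod (E := E) (F := F) n hN hrR K C₀ α₀ hα₀
  refine ⟨C, β, hβ, fun V z hV hK hH => ?_⟩
  have hsub : parabolicCylinder r z ⊆ Ioo (z.1 - R ^ 2) z.1 ×ˢ ball z.2 r := by
    intro w hw
    rw [mem_parabolicCylinder] at hw
    have : r ^ 2 < R ^ 2 := by nlinarith
    exact mem_prod.2 ⟨⟨by linarith [hw.1.1], hw.1.2⟩, hw.2⟩
  refine (h V (Ioo (z.1 - R ^ 2) z.1) z.2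
    (fun t ht y hy => hV (t, y) (mem_parabolicCylinder.2 ⟨ht, hy⟩))
    (fun m hm t ht y hy => hK m hm (t, y) (mem_parabolicCylinder.2 ⟨ht, hy⟩))
    (fun t ht s hs y hy => ?_)).mono hsub
  have key := hH.dist_le (mem_parabolicCylinder.2 ⟨ht, hy⟩ : (t, y) ∈ parabolicCylinder R z)
    (mem_parabolicCylinder.2 ⟨hs, hy⟩ : (s, y) ∈ parabolicCylinder R z)
  rw [uncurry_apply_pair, uncurry_apply_pair, dist_eq_norm, Prod.dist_eq, dist_self,
    Real.dist_eq, max_eq_left (abs_nonneg _)] at key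
  exact key

/-- **The same on centred parabolic cylinders** `Q*(z, R) = ]t₀ - R², t₀ + R²[ × B(x₀, R)`.
[folklore] -/
theorem exists_holderOnWith_iteratedFDeriv_parabolicCylinderCentered (n : ℕ) {N : WithTop ℕ∞}
    (hN : ((n + 1 : ℕ) : WithTop ℕ∞) ≤ N) {r R : ℝ} (hr : 0 < r) (hrR : r < R) (K : ℕ → ℝ≥0)
    (C₀ α₀ : ℝ≥0) (hα₀ : 0 < α₀) :
    ∃ C α : ℝ≥0, 0 < α ∧ ∀ (V : ℝ → E → F) (z : ℝ × E),
      (∀ w ∈ parabolicCylinderCentered R z, ContDiffAt ℝ N (V w.1) w.2) →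
      (∀ m ≤ n + 1, ∀ w ∈ parabolicCylinderCentered R z, ‖iteratedFDeriv ℝ m (V w.1) w.2‖ ≤ K m) →
      HolderOnWith C₀ α₀ (uncurry V) (parabolicCylinderCentered R z) →
      HolderOnWith C α (fun w : ℝ × E => iteratedFDeriv ℝ n (V w.1) w.2)
        (parabolicCylinderCentered r z) := by
  obtain ⟨C, β, hβ, h⟩ :=
    exists_holderOnWith_iteratedFDeriv_prod (E := E) (F := F) n hN hrR K C₀ α₀ hα₀
  refine ⟨C, β, hβ, fun V z hV hK hH => ?_⟩
  have hsub : parabolicCylinderCentered r z ⊆ Ioo (z.1 - R ^ 2) (z.1 + R ^ 2) ×ˢ ball z.2 r := by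
    intro w hw
    rw [mem_parabolicCylinderCentered] at hw
    have : r ^ 2 < R ^ 2 := by nlinarith
    exact mem_prod.2 ⟨⟨by linarith [hw.1.1], by linarith [hw.1.2]⟩, hw.2⟩
  refine (h V (Ioo (z.1 - R ^ 2) (z.1 + R ^ 2)) z.2
    (fun t ht y hy => hV (t, y) (mem_parabolicCylinderCentered.2 ⟨ht, hy⟩))
    (fun m hm t ht y hy => hK m hm (t, y) (mem_parabolicCylinderCentered.2 ⟨ht, hy⟩))
    (fun t ht s hs y hy => ?_)).mono hsub
  have key := hH.dist_le
    (mem_parabolicCylinderCentered.2 ⟨ht, hy⟩ : (t, y) ∈ parabolicCylinderCentered R z)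
    (mem_parabolicCylinderCentered.2 ⟨hs, hy⟩ : (s, y) ∈ parabolicCylinderCentered R z)
  rw [uncurry_apply_pair, uncurry_apply_pair, dist_eq_norm, Prod.dist_eq, dist_self,
    Real.dist_eq, max_eq_left (abs_nonneg _)] at key
  exact key

/-- **All orders at once, for representatives with `C^∞` slices** (exactly the clauses of
`NSBoundedHigherRegularityBounds`): if the slices of `V` are `C^∞` at the points of `Q(z, R)`
with `‖D_x^m V‖ ≤ K m` there for all `m`, and `V` is `(C₀, α₀)`-Hölder on `Q(z, R)`, then for
every `n` the derivative `w ↦ D_xⁿV(w)` is `(C n, α n)`-Hölder on `Q(z, r)`, `0 < r < R`, with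
`C n`, `α n > 0` depending only on `n, r, R, K, C₀, α₀`. [folklore] -/
theorem exists_holderOnWith_iteratedFDeriv_parabolicCylinder_smooth {r R : ℝ} (hr : 0 < r)
    (hrR : r < R) (K : ℕ → ℝ≥0) (C₀ α₀ : ℝ≥0) (hα₀ : 0 < α₀) :
    ∃ C α : ℕ → ℝ≥0, (∀ n, 0 < α n) ∧ ∀ (V : ℝ → E → F) (z : ℝ × E),
      (∀ w ∈ parabolicCylinder R z, ContDiffAt ℝ (⊤ : ℕ∞) (V w.1) w.2) →
      (∀ m, ∀ w ∈ parabolicCylinder R z, ‖iteratedFDeriv ℝ m (V w.1) w.2‖ ≤ K m) →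
      HolderOnWith C₀ α₀ (uncurry V) (parabolicCylinder R z) →
      ∀ n, HolderOnWith (C n) (α n) (fun w : ℝ × E => iteratedFDeriv ℝ n (V w.1) w.2)
        (parabolicCylinder r z) := by
  have h := fun n : ℕ => exists_holderOnWith_iteratedFDeriv_parabolicCylinder (E := E) (F := F) n
    (N := ((⊤ : ℕ∞) : WithTop ℕ∞)) (by exact_mod_cast le_top) hr hrR K C₀ α₀ hα₀
  choose C α hα hH using h
  exact ⟨C, α, hα, fun V z hV hK hHV n => hH n V z hV (fun m _ w hw => hK m w hw) hHV⟩

end DerivInterp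

end Literature.Analysis.FluidPDE
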